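import Summits.Ventures.DiscreteObjects.PP12.PrimeOrderStructure
import Summits.Ventures.DiscreteObjects.PP12.FanoFiveOrbitMatrix
import Literature.Combinatorics.Designs.ProjectivePlaneOrder12Collineations

/-!
# PP(12): the cyclic collineation group of one collineation, and the cells `p ≥ 5` FROM the Janko–van Trung named fact (kernel; bookkeeping)
Framing: lottery ticket; floor = certified bounds/negative ranges.

Cell pub-namedobj (venture DiscreteObjects), target (M), designs gen 15. Converse bookkeeping to `TwoThreeGroupReduction` (named fact ⇐ cells):
a single collineation `σ` generates a collineation group in the sense of the Literature definition `IsCollineationGroup` (a finite group acting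
on points and lines, faithfully on points, preserving incidence): `Collineation.cyc σ = zpowers (σ.onPoints, σ.onLines) ≤ Perm P × Perm L`
(`isCollineationGroup_cyc`; faithfulness on points uses that in a projective plane a line is determined by its points). Hence the named fact
`CollineationGroupIsTwoThreeGroup` (Janko–van Trung 1982) gives every plane-level prime cell `p ≠ 2, 3` at once (`eq_one_of_twoThreeGroup`), in
particular `NoOrderFiveOrder12` (`noOrderFive_of_twoThreeGroup`). Nothing here asserts the named fact. No `sorry`, no new axioms.
-/

namespace Summit.Ventures.DiscreteObjects.PP12

open Configuration
open scoped Classical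

/-- **Incidence-preserving pairs** `(permutation of points, permutation of lines)` form a subgroup of `Perm P × Perm L`. -/
def incSubgroup (P L : Type*) [Membership P L] : Subgroup (Equiv.Perm P × Equiv.Perm L) where
  carrier := {x | ∀ (p : P) (l : L), x.1 p ∈ x.2 l ↔ p ∈ l}
  mul_mem' := by
    intro x y hx hy p l
    simp only [Set.mem_setOf_eq, Prod.fst_mul, Prod.snd_mul, Equiv.Perm.mul_apply] at *
    rw [hx, hy]
  one_mem' := by
    intro p l
    simp
  inv_mem' := by
    intro x hx p l
    show x⁻¹.1 p ∈ x⁻¹.2 l ↔ p ∈ l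
    rw [Prod.fst_inv, Prod.snd_inv]
    have h := hx (x.1⁻¹ p) (x.2⁻¹ l)
    rw [show x.1 (x.1⁻¹ p) = p from x.1.apply_symm_apply p, show x.2 (x.2⁻¹ l) = l from x.2.apply_symm_apply l] at h
    exact h.symm

/-- In a projective plane the line part of an incidence-preserving pair is determined by its point part. -/
theorem incSubgroup_snd_eq_of_fst_eq {P L : Type*} [Membership P L] [ProjectivePlane P L] [Fintype P] [Fintype L]
    {x y : Equiv.Perm P × Equiv.Perm L} (hx : x ∈ incSubgroup P L) (hy : y ∈ incSubgroup P L) (h : x.1 = y.1) : x.2 = y.2 := by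
  ext m
  obtain ⟨a, b, -, ha, hb, -, hab, -, -⟩ := Collineation.exists_three_points (P := P) m
  have ha1 : x.1 a ∈ x.2 m := (hx a m).2 ha
  have hb1 : x.1 b ∈ x.2 m := (hx b m).2 hb
  have ha2 : x.1 a ∈ y.2 m := by rw [h]; exact (hy a m).2 ha
  have hb2 : x.1 b ∈ y.2 m := by rw [h]; exact (hy b m).2 hb
  have hab' : x.1 a ≠ x.1 b := fun e => hab (x.1.injective e)
  exact (Nondegenerate.eq_or_eq ha1 hb1 ha2 hb2).resolve_left hab'

namespace Collineation

variable {P L : Type*} [Membership P L] (σ : Collineation P L)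

/-- `σ` as an element of `Perm P × Perm L`. -/
def toProd : Equiv.Perm P × Equiv.Perm L := (σ.onPoints, σ.onLines)

/-- First component of `toProd`. -/
@[simp] theorem toProd_fst : σ.toProd.1 = σ.onPoints := rfl

/-- Second component of `toProd`. -/
@[simp] theorem toProd_snd : σ.toProd.2 = σ.onLines := rfl

/-- `σ` preserves incidence. -/
theorem toProd_mem_incSubgroup : σ.toProd ∈ incSubgroup P L := fun p l => σ.mem_iff p l

/-- **The cyclic collineation group generated by `σ`** (a subgroup of `Perm P × Perm L`). -/
abbrev cyc : Subgroup (Equiv.Perm P × Equiv.Perm L) := Subgroup.zpowers σ.toProd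

/-- Every element of `σ.cyc` preserves incidence. -/
theorem cyc_le_incSubgroup : σ.cyc ≤ incSubgroup P L := by
  rw [Subgroup.zpowers_le]
  exact σ.toProd_mem_incSubgroup

/-- `σ.cyc` acts on points through the first component. -/
instance cycActionPoints : MulAction σ.cyc P := MulAction.compHom P ((MonoidHom.fst _ _).comp σ.cyc.subtype)

/-- `σ.cyc` acts on lines through the second component. -/
instance cycActionLines : MulAction σ.cyc L := MulAction.compHom L ((MonoidHom.snd _ _).comp σ.cyc.subtype)

/-- Unfolding the point action. -/
theorem cyc_smul_point (g : σ.cyc) (p : P) : g • p = g.1.1 p := rfl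

/-- Unfolding the line action. -/
theorem cyc_smul_line (g : σ.cyc) (l : L) : g • l = g.1.2 l := rfl

variable [ProjectivePlane P L] [Fintype P] [Fintype L]

/-- **`σ.cyc` is a collineation group** (Literature `IsCollineationGroup`: faithful on points, incidence-preserving). -/
theorem isCollineationGroup_cyc : Literature.Combinatorics.Designs.IsCollineationGroup σ.cyc P L := by
  refine ⟨⟨fun {g h} hgh => ?_⟩, fun g p l => ?_⟩
  · have h1 : g.1.1 = h.1.1 := Equiv.ext fun p => by
      have := hgh p
      rwa [cyc_smul_point, cyc_smul_point] at this
    exact Subtype.ext (Prod.ext h1 (incSubgroup_snd_eq_of_fst_eq (σ.cyc_le_incSubgroup g.2) (σ.cyc_le_incSubgroup h.2) h1))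
  · rw [cyc_smul_point, cyc_smul_line]
    exact ((σ.cyc_le_incSubgroup g.2) p l).symm

omit [ProjectivePlane P L] in
/-- `orderOf σ.onPoints` divides the order of `σ.cyc`. -/
theorem orderOf_onPoints_dvd_card_cyc : orderOf σ.onPoints ∣ Fintype.card σ.cyc := by
  have hcard : Fintype.card σ.cyc = orderOf σ.toProd := by
    rw [← Nat.card_eq_fintype_card]; exact Nat.card_zpowers _
  rw [hcard]
  apply orderOf_dvd_of_pow_eq_one
  have e := congrArg Prod.fst (pow_orderOf_eq_one σ.toProd)
  rw [Prod.pow_fst, Prod.fst_one, toProd_fst] at e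
  exact e

end Collineation

open Literature.Combinatorics.Designs in
/-- **Every plane-level prime cell `p ≠ 2, 3` from the named fact:** under Janko–van Trung's `{2,3}`-group theorem a collineation `σ` with `σ ^ p = 1`,
`p` prime, `p ≠ 2, 3`, of a projective plane of order 12 is the identity. -/
theorem eq_one_of_twoThreeGroup (hJvT : CollineationGroupIsTwoThreeGroup)
    (P L : Type) [Membership P L] [Fintype P] [Fintype L] [ProjectivePlane P L] (h12 : ProjectivePlane.order P L = 12)
    (σ : Collineation P L) {p : ℕ} (hp : p.Prime) (hp2 : p ≠ 2) (hp3 : p ≠ 3) (hq : σ.onPoints ^ p = 1) : σ.onPoints = 1 := by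
  by_contra hne
  haveI : Fact p.Prime := ⟨hp⟩
  have hord : orderOf σ.onPoints = p := orderOf_eq_prime hq hne
  have hdvd : p ∣ Fintype.card σ.cyc := hord ▸ σ.orderOf_onPoints_dvd_card_cyc
  rcases hJvT P L h12 σ.cyc σ.isCollineationGroup_cyc p hp hdvd with h | h
  · exact hp2 h
  · exact hp3 h

open Literature.Combinatorics.Designs in
/-- In particular the named fact gives the order-5 cell `NoOrderFiveOrder12`. -/
theorem noOrderFive_of_twoThreeGroup (hJvT : CollineationGroupIsTwoThreeGroup) : NoOrderFiveOrder12 :=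
  fun P L _ _ _ _ h12 σ hq => eq_one_of_twoThreeGroup hJvT P L h12 σ Nat.prime_five (by norm_num) (by norm_num) hq

end Summit.Ventures.DiscreteObjects.PP12
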